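import Summits.Ventures.QEC.Census.AdditiveCertScan
import HarnessLib

/-!
# Brute-force certificates for general (additive, non-CSS) stabilizer codes: the checker and its soundness

The CSS checker `Census/CertCheck.lean` (type-10) reads a code as a pair `(H^X, H^Z)`; the 105 non-CSS codes of the
calibration census (search-5: hexacode, `[[5,1,3]]`, `[[8,3,3]]`, dodecacode family …, CRSS 1998 Table III) need the
GENERAL stabilizer format of plan/CERT-FORMAT.md v1.2 §3S: generators as Pauli words `(x|z)` (two bitmasks over the
qubits, bit `j` = qubit `j`, type-01's `ofBitPair`), syndromes by the symplectic inner product. This file is that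
kernel end:

* `AddCert` — the Lean literal: `n`, `rows` (INDEPENDENT generators `(x-mask, z-mask)`), `rinv` (symplectic rank
  certificate: partners with `⟨rows[a], rinv[i]⟩ = [a = i]`), `d`, `witness` / `witnessCoef` / `nonmember`
  (upper witness: for `k > 0` a logical of weight `d` with a non-membership witness; for `k = 0` a nonzero
  stabilizer of weight `d` as an explicit row combination), `found` (allow-list of every zero-syndrome word of weight
  `≤ d − 1` with its row combination); `k := n − |rows|` is COMPUTED, not claimed;
* `AddCert.check : AddCert → Bool` — commutation of the rows, the rank table, the upper witness, the allow-list
  decompositions, and the REPLAYED brute force `scan4` (structural I/X/Z/Y recursion over the qubits with budget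
  `d − 1`: every Pauli word of weight `≤ d − 1` has nonzero syndrome, or is the identity, or (`k > 0`) is
  allow-listed) — pure `List`/`Nat` recursion, closed by `decide` (tier KERNEL) or `native_decide` (COMPILED, flagged);
* SOUNDNESS into the tree's vocabulary (lit-1's `SymplecticCodes.lean`, type-02's `StabilizerDistance.lean`):
  `isSelfOrthogonal_code`, `finrank_code` (`dim S̄ = |rows|`), **`isAdditiveCode_of_check`**
  (`check c = true → IsAdditiveCode c.code (c.n − |rows|) c.d`, CRSS Thm. 1's `[[n,k,d]]` incl. the `k = 0`
  convention), **`minDistance_code_of_check`** (`k > 0 → minDistance c.code = c.d`, exact distance) and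
  `additiveCodeExists_of_check`;
* control: the `[[5,1,3]]` code (generators `XZZXI` cyclic = lit-1's `fiveQubitRows`, logical `Y₀Z₁Y₂` of
  Gottesman §3.3 as the weight-3 witness) certified `[[5,1,3]]` with EXACT distance 3 by `decide` — tier KERNEL.

The checker never trusts the producer: every parity, weight and XOR is recomputed; a certificate that passes IS a proof.
Word layer, the replay `scan4` and its completeness: the sibling file `Census/AdditiveCertScan.lean`.
-/

namespace Summit.Ventures.QEC.Census

open Matrix Literature.InformationTheory.QuantumCodes

/-! ## The certificate and the checker -/

/-- A brute-force certificate for a general stabilizer code (CERT-FORMAT v1.2 §3S, kernel-relevant fields). -/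
structure AddCert where
  /-- number of qubits -/
  n : ℕ
  /-- INDEPENDENT generators as packed Pauli words `(x-mask, z-mask)` -/
  rows : List (ℕ × ℕ)
  /-- symplectic rank certificate: `|rows|` words with `⟨rows[a], rinv[i]⟩` odd iff `a = i` -/
  rinv : List (ℕ × ℕ)
  /-- claimed minimum distance -/
  d : ℕ
  /-- `k > 0`: a logical operator of weight `d`; `k = 0`: a nonzero stabilizer of weight `d` -/
  witness : ℕ × ℕ
  /-- `k = 0` only: coefficient bitmask over `rows` XOR-ing to `witness` -/
  witnessCoef : ℕ
  /-- `k > 0` only: a word commuting with every row and anticommuting with `witness` -/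
  nonmember : ℕ × ℕ
  /-- `k > 0` only: allow-list `(word, coefficient bitmask)`: every zero-syndrome word of weight `≤ d − 1` -/
  found : List ((ℕ × ℕ) × ℕ)

namespace AddCert

variable (c : AddCert)

/-- All generators pairwise commute. -/
def commOK : Bool := c.rows.all fun r => c.rows.all fun r' => sympParity c.n r r' == 0

/-- The symplectic rank table: `|rinv| = |rows|` and `⟨rows[a], rinv[i]⟩ ≡ [a = i] (mod 2)`. -/
def indepOK : Bool :=
  (c.rinv.length == c.rows.length) &&
    (List.range c.rows.length).all fun a => (List.range c.rows.length).all fun i =>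
      sympParity c.n (c.rows.getD a (0, 0)) (c.rinv.getD i (0, 0)) == (if a = i then 1 else 0)

/-- `k > 0` upper witness: a weight-`d` word with zero syndrome and a non-membership witness. -/
def upperOK : Bool :=
  sympSynZero c.n c.rows c.witness && (pw c.n c.witness == c.d) && sympSynZero c.n c.rows c.nonmember &&
    (sympParity c.n c.nonmember c.witness == 1)

/-- `k = 0` witness: an explicit row combination of weight `d`. -/
def zeroOK : Bool := (xorPairs c.rows c.witnessCoef == c.witness) && (pw c.n c.witness == c.d)

/-- Every allow-list entry is the XOR of its selected rows. -/
def foundOK : Bool := c.found.all fun e => xorPairs c.rows e.2 == e.1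

/-- The replay over all Pauli words of weight `≤ d − 1` on qubits `0 … n−1`. -/
def replay (allow : List (ℕ × ℕ)) : Bool := scan4 (leaf c.n c.rows allow) (List.range c.n) (c.d - 1) 0 0

/-- **The checker.** `k := n − |rows|`; for `k > 0` the upper witness, allow-list and replay; for `k = 0` the
stabilizer witness and the replay with EMPTY allow-list (no nonzero stabilizer below weight `d`). -/
def check : Bool :=
  c.commOK && c.indepOK && decide (c.rows.length ≤ c.n) &&
    (if c.rows.length < c.n then c.upperOK && c.foundOK && c.replay (c.found.map Prod.fst)
     else c.zeroOK && c.replay [])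

/-- The generators as vectors of `Ē = 𝔽₂ⁿ × 𝔽₂ⁿ`. -/
def rowVec : Fin c.rows.length → SympVec c.n := fun i => ofBitPair c.n (c.rows[i]).1 (c.rows[i]).2

/-- **The code of the certificate**: the span of the generators (an additive code `S̄ ≤ Ē`). -/
def code : Submodule (ZMod 2) (SympVec c.n) := Submodule.span (ZMod 2) (Set.range c.rowVec)

/-- The number of logical qubits the certificate establishes: `k = n − |rows|`. -/
def k : ℕ := c.n - c.rows.length

end AddCert

/-! ## Soundness: the code of a certificate -/

namespace AddCert

variable (c : AddCert)

/-- Row `i` as a vector is `ofBitPair` of the `i`-th listed word. -/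
theorem rowVec_apply (i : Fin c.rows.length) : c.rowVec i = ofBitPair c.n (c.rows[i]).1 (c.rows[i]).2 := rfl

/-- `l.getD i d = l[i]` for an index in range. -/
private theorem getD_eq_getElem {α : Type*} {l : List α} {i : ℕ} {dflt : α} (h : i < l.length) :
    l.getD i dflt = l[i] := by
  rw [List.getD_eq_getElem?_getD, List.getElem?_eq_getElem h, Option.getD_some]

/-- Zero syndrome against the listed rows = membership in the symplectic dual of the code. -/
theorem mem_sympDual_code_iff (w : ℕ × ℕ) :
    ofBitPair c.n w.1 w.2 ∈ sympDual c.code ↔ sympSynZero c.n c.rows w = true := by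
  rw [code, mem_sympDual_span_range_iff, sympSynZero_iff]
  constructor
  · intro h r hr
    obtain ⟨i, hi, rfl⟩ := List.getElem_of_mem hr
    exact h ⟨i, hi⟩
  · intro h i
    exact h _ (List.getElem_mem i.2)

/-- A XOR of selected rows lies in the code. -/
theorem ofBitPair_xorPairs_mem_code (coef : ℕ) :
    ofBitPair c.n (xorPairs c.rows coef).1 (xorPairs c.rows coef).2 ∈ c.code := by
  -- generalise over the row list: a XOR of rows of `rows` lies in the span of (the vectors of) `rows`
  suffices h : ∀ (rows : List (ℕ × ℕ)) (cf : ℕ),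
      ofBitPair c.n (xorPairs rows cf).1 (xorPairs rows cf).2 ∈
        Submodule.span (ZMod 2) {v | ∃ r ∈ rows, v = ofBitPair c.n r.1 r.2} by
    refine Submodule.span_mono ?_ (h c.rows coef)
    rintro _ ⟨r, hr, rfl⟩
    obtain ⟨i, hi, rfl⟩ := List.getElem_of_mem hr
    exact ⟨⟨i, hi⟩, rfl⟩
  intro rows
  induction rows with
  | nil => intro cf; rw [xorPairs, ofBitPair_zero]; exact Submodule.zero_mem _
  | cons r rest ih =>
    intro cf
    have hsub : Submodule.span (ZMod 2) {v | ∃ r' ∈ rest, v = ofBitPair c.n r'.1 r'.2} ≤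
        Submodule.span (ZMod 2) {v | ∃ r' ∈ r :: rest, v = ofBitPair c.n r'.1 r'.2} :=
      Submodule.span_mono fun v ⟨r', hr', hv⟩ => ⟨r', List.mem_cons_of_mem _ hr', hv⟩
    rw [xorPairs]
    split
    · rw [ofBitPair_xor]
      exact Submodule.add_mem _ (Submodule.subset_span ⟨r, List.mem_cons_self, rfl⟩) (hsub (ih (cf / 2)))
    · exact hsub (ih (cf / 2))

/-- **Commutation ⇒ self-orthogonal**: a passing `commOK` makes the code an abelian stabilizer. -/
theorem isSelfOrthogonal_code (h : c.commOK = true) : IsSelfOrthogonal c.code := by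
  rw [code, isSelfOrthogonal_span_range_iff]
  intro i j
  simp only [commOK, List.all_eq_true, beq_iff_eq] at h
  rw [rowVec_apply, rowVec_apply, ← sympParity_eq_zero_iff]
  exact h _ (List.getElem_mem i.2) _ (List.getElem_mem j.2)

/-- **Rank table ⇒ independence**: a passing `indepOK` makes the generators linearly independent. -/
theorem linearIndependent_rowVec (h : c.indepOK = true) : LinearIndependent (ZMod 2) c.rowVec := by
  simp only [indepOK, Bool.and_eq_true, beq_iff_eq, List.all_eq_true, List.mem_range] at h
  obtain ⟨hlen, htab⟩ := h
  rw [Fintype.linearIndependent_iff]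
  intro g hg i
  -- pair the relation with the partner `rinv[i]`
  let u : SympVec c.n := ofBitPair c.n (c.rinv.getD i (0, 0)).1 (c.rinv.getD i (0, 0)).2
  have h0 : sympForm c.n (∑ a, g a • c.rowVec a) u = 0 := by rw [hg, map_zero, LinearMap.zero_apply]
  rw [map_sum, LinearMap.sum_apply] at h0
  simp only [map_smul, LinearMap.smul_apply, sympForm_apply, smul_eq_mul] at h0
  have htab' : ∀ a : Fin c.rows.length, sympInner (c.rowVec a) u = if a = i then 1 else 0 := fun a => by
    have hra : c.rowVec a = ofBitPair c.n (c.rows.getD a (0, 0)).1 (c.rows.getD a (0, 0)).2 := by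
      rw [getD_eq_getElem a.2]; rfl
    rw [hra, sympInner_ofBitPair_eq_sympParity, htab a a.2 i i.2]
    by_cases hai : a = i
    · simp [hai]
    · simp [hai, Fin.val_eq_val]
  simp only [htab', mul_ite, mul_one, mul_zero, Finset.sum_ite_eq', Finset.mem_univ, if_true] at h0
  exact h0

/-- Hence **`dim S̄ = |rows|`**. -/
theorem finrank_code (h : c.indepOK = true) : Module.finrank (ZMod 2) c.code = c.rows.length := by
  rw [code, finrank_span_eq_card (c.linearIndependent_rowVec h), Fintype.card_fin]

end AddCert

/-! ## Soundness of the checker -/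

namespace AddCert

variable (c : AddCert)

/-- What a passing replay gives: every `w ∈ Ē` of weight `≤ d − 1` passes the leaf test at its own packed form. -/
theorem leaf_of_replay {allow : List (ℕ × ℕ)} (h : c.replay allow = true) (w : SympVec c.n)
    (hw : sympWeight w ≤ c.d - 1) :
    leaf c.n c.rows allow (accX (suppSel c.n w)) (accZ (suppSel c.n w)) = true := by
  have := scan4_complete _ _ _ 0 0 h (suppSel c.n w) (suppSel_sublist c.n w)
    (by rw [length_suppSel]; exact hw)
  simpa [Nat.zero_xor] using this

/-- **Lower bound**: after a passing replay with an allow-list of row combinations, every element of `S̄⊥ ∖ S̄`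
has weight `≥ d`. -/
theorem hasMinDist_of_replay {allow : List (ℕ × ℕ)} (hrep : c.replay allow = true)
    (hallow : ∀ a ∈ allow, ofBitPair c.n a.1 a.2 ∈ c.code) : HasMinDist c.code c.d := by
  intro w hw hw'
  by_contra hlt
  have hle : sympWeight w ≤ c.d - 1 := by omega
  have hleaf := c.leaf_of_replay hrep w hle
  set x := accX (suppSel c.n w) with hx
  set z := accZ (suppSel c.n w) with hz
  have hwxz : ofBitPair c.n x z = w := ofBitPair_acc_suppSel c.n w
  rcases leaf_cases hleaf with hsyn | ⟨hx0, hz0⟩ | hmem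
  · -- nonzero syndrome contradicts `w ∈ S̄⊥`
    have := (c.mem_sympDual_code_iff (x, z)).1 (by rw [hwxz]; exact hw)
    rw [hsyn] at this
    exact Bool.false_ne_true this
  · -- the identity word lies in `S̄`
    apply hw'
    rw [← hwxz, hx0, hz0, ofBitPair_zero]
    exact Submodule.zero_mem _
  · -- an allow-listed word lies in `S̄`
    exact hw' (hwxz ▸ hallow _ hmem)

/-- The allow-list check makes every allow-listed word a row combination, hence an element of the code. -/
theorem allow_mem_code (h : c.foundOK = true) :
    ∀ a ∈ c.found.map Prod.fst, ofBitPair c.n a.1 a.2 ∈ c.code := by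
  intro a ha
  simp only [foundOK, List.all_eq_true, beq_iff_eq] at h
  obtain ⟨e, he, rfl⟩ := List.mem_map.1 ha
  rw [← h e he]
  exact c.ofBitPair_xorPairs_mem_code e.2

/-- **Soundness, `k > 0`**: a passing check with `|rows| < n` gives the exact minimum distance `d`. -/
theorem minDistance_code_of_check (h : c.check = true) (hk : c.rows.length < c.n) :
    minDistance c.code = c.d := by
  simp only [check, if_pos hk, Bool.and_eq_true, decide_eq_true_eq] at h
  obtain ⟨⟨⟨-, -⟩, -⟩, ⟨hup, hfound⟩, hrep⟩ := h
  simp only [upperOK, Bool.and_eq_true, beq_iff_eq] at hup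
  obtain ⟨⟨⟨hsyn, hwt⟩, hnm⟩, hanti⟩ := hup
  refine minDistance_eq_of_witness ((c.mem_sympDual_code_iff c.witness).2 hsyn) ?_ ?_
    (c.hasMinDist_of_replay hrep (c.allow_mem_code hfound))
  · -- the witness is not a stabilizer: it anticommutes with `nonmember ∈ S̄⊥`
    intro hmem
    have hu := (c.mem_sympDual_code_iff c.nonmember).2 hnm
    have h0 : sympInner (ofBitPair c.n c.witness.1 c.witness.2)
        (ofBitPair c.n c.nonmember.1 c.nonmember.2) = 0 := (mem_sympDual_iff.1 hu) _ hmem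
    rw [sympInner_comm] at h0
    exact sympInner_ne_zero_of_sympParity_eq_one c.n hanti h0
  · rw [sympWeight_ofBitPair_eq_pw, hwt]

/-- **Soundness (CRSS Thm. 1 form)**: a passing check makes the code an `[[n, n − |rows|, d]]` additive code —
self-orthogonal, `dim S̄ + k = n`, no logical operator below weight `d`, and (for `k = 0`) no nonzero stabilizer
below weight `d`. -/
theorem isAdditiveCode_of_check (h : c.check = true) : IsAdditiveCode c.code c.k c.d := by
  have h' := h
  simp only [check, Bool.and_eq_true, decide_eq_true_eq] at h'
  obtain ⟨⟨⟨hcomm, hind⟩, hle⟩, hrest⟩ := h'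
  have hso := c.isSelfOrthogonal_code hcomm
  have hdim := c.finrank_code hind
  refine ⟨hso, by rw [hdim, k]; omega, ?_, ?_⟩
  · -- HasMinDist
    by_cases hk : c.rows.length < c.n
    · rw [if_pos hk, Bool.and_eq_true, Bool.and_eq_true] at hrest
      exact c.hasMinDist_of_replay hrest.2 (c.allow_mem_code hrest.1.2)
    · -- `k = 0`: `S̄⊥ = S̄`, the condition is vacuous
      have heq : c.rows.length = c.n := le_antisymm hle (not_lt.1 hk)
      have hSS : sympDual c.code = c.code := by
        refine (Submodule.eq_of_le_of_finrank_le hso ?_).symm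
        have := finrank_sympDual_add c.code
        omega
      intro w hw hw'
      exact absurd (hSS ▸ hw) hw'
  · -- the `k = 0` clause: no nonzero stabilizer below weight `d`
    intro hk0 v hv hv0
    have hk : ¬ c.rows.length < c.n := fun hlt => by simp [k] at hk0; omega
    rw [if_neg hk, Bool.and_eq_true] at hrest
    by_contra hlt
    have hle' : sympWeight v ≤ c.d - 1 := by omega
    have hleaf := c.leaf_of_replay hrest.2 v hle'
    have hwxz := ofBitPair_acc_suppSel c.n v
    rcases leaf_cases hleaf with hsyn | ⟨h1, h2⟩ | hmem
    · have hvdual : v ∈ sympDual c.code := hso hv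
      have := (c.mem_sympDual_code_iff (accX (suppSel c.n v), accZ (suppSel c.n v))).1
        (by rw [hwxz]; exact hvdual)
      rw [hsyn] at this
      exact Bool.false_ne_true this
    · apply hv0
      rw [← hwxz, h1, h2, ofBitPair_zero]
    · exact absurd hmem List.not_mem_nil

/-- **`k = 0` exactness**: the witness is a stabilizer of weight exactly `d` (so `d` is the least nonzero
stabilizer weight, together with the `k = 0` clause of `isAdditiveCode_of_check`). -/
theorem exists_stabilizer_weight_eq_of_check (h : c.check = true) (hk : ¬ c.rows.length < c.n) :
    ∃ v ∈ c.code, sympWeight v = c.d := by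
  simp only [check, if_neg hk, Bool.and_eq_true, decide_eq_true_eq, zeroOK, beq_iff_eq] at h
  obtain ⟨-, ⟨hw, hwt⟩, -⟩ := h
  refine ⟨ofBitPair c.n c.witness.1 c.witness.2, ?_, by rw [sympWeight_ofBitPair_eq_pw, hwt]⟩
  rw [← hw]
  exact c.ofBitPair_xorPairs_mem_code c.witnessCoef

/-- **The parameters are realised**: `[[n, n − |rows|, d]]` exists (CRSS's `AdditiveCodeExists`). -/
theorem additiveCodeExists_of_check (h : c.check = true) : AdditiveCodeExists c.n c.k c.d :=
  ⟨c.code, c.isAdditiveCode_of_check h⟩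

end AddCert

/-! ## Control: the five-qubit code is a `[[5, 1, 3]]` code, tier KERNEL -/

/-- Certificate of the `[[5,1,3]]` code: generators `XZZXI, IXZZX, XIXZZ, ZXIXZ` (lit-1's `fiveQubitRows`, packed:
x-mask / z-mask with bit `j` = qubit `j`), rank partners (`X₁, Z₄, Z₂, X₀` anticommute with exactly one generator each), the weight-3 logical
`Y₀Z₁Y₂` (Gottesman 1997 §3.3: "`Y₁Z₂Y₃ ∈ N(S) − S`") with the non-membership witness `X̄ = XXXXX`, and the (empty) allow-list: no Pauli of weight `≤ 2` commutes with all four generators. -/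
def certC513 : AddCert where
  n := 5
  rows := [(0b01001, 0b00110), (0b10010, 0b01100), (0b00101, 0b11000), (0b01010, 0b10001)]
  rinv := [(0b00010, 0b00000), (0b00000, 0b10000), (0b00000, 0b00100), (0b00001, 0b00000)]
  d := 3
  witness := (0b00101, 0b00111)
  witnessCoef := 0
  nonmember := (0b11111, 0b00000)
  found := []

/-- The checker accepts the `[[5,1,3]]` certificate (by `decide`: tier KERNEL). -/
theorem check_certC513 : certC513.check = true := by decide

/-- **`[[5,1,3]]` CERTIFIED**: the span of the four generators is a `[[5, 1, 3]]` additive code … -/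
theorem isAdditiveCode_certC513 : IsAdditiveCode certC513.code 1 3 :=
  certC513.isAdditiveCode_of_check check_certC513

/-- … with minimum distance EXACTLY `3`. -/
theorem minDistance_certC513 : minDistance certC513.code = 3 :=
  certC513.minDistance_code_of_check check_certC513 (by decide)

end Summit.Ventures.QEC.Census
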